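import Mathlib
import HarnessLib

-- provenance: harness21/H21/H21/Statements/Hubbard/Wave0.lean @ 5292808 (interim HEAD d8f2665); M5 mechanical rewrite
/-!
# Hubbard family — wave 0 statements

Family `hubbard` (trunk T-QLATTICE) of the H21 gap inventory
(`gap-inventory/2026-08-12/families/hubbard.json`).

## Covered statement ids

* **hubbard.S04** — finite fermionic Fock space with creation/annihilation operators and the CAR
  (Bratteli–Robinson II §5.2.2; Tasaki 2020 §9.2).
* **hubbard.S05** — the Hubbard Hamiltonian on a finite graph, number operators, sectors,
  ground-state energy (Hubbard 1963; Lieb 1995 §2).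
* **hubbard.S06** — Yang's two-particle reduced density matrix and the ODLRO predicate
  (Yang 1962 §§3–4).
* **hubbard.S07** — Yang's bound `λ_max(ρ₂) ≤ N(M − N + 2)/M` (Yang 1962).
* **hubbard.S09** — Lieb's two theorems on the Hubbard ground state (Lieb, PRL 62 (1989) 1201).

## Skipped

All other ids (S01–S03, S08, S10–S25): they need spin-chain Hilbert spaces with local operator
support, thermodynamic limits, Gibbs/KMS states, quasi-local algebras, matrix product states,
Bessel functions or the (ambiguous) spin-liquid / d-wave design decisions — each well beyond the
~60 lines of local glue allowed for wave 0. S01 additionally depends on the flagged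
pair-field-vs-`ρ₂` design decision.

## Design choices (local glue, to be superseded by `Literature.Prelude.QLattice`)

* The Fock space over a finite, linearly ordered orbital set `ι` is modelled concretely as
  `ℓ²(Finset ι)`, i.e. vectors `Finset ι → ℂ` with the inner product `star ψ ⬝ᵥ φ`; operators are
  matrices `Matrix (Finset ι) (Finset ι) ℂ` acting by `Matrix.mulVec`, products are matrix
  products and adjoints are `Matrix.conjTranspose`. This avoids building an inner-product
  structure on `ExteriorAlgebra` (absent from Mathlib).
* The Jordan–Wigner sign of `c_i` on the basis vector `|s⟩` is `(-1) ^ #{j ∈ s | j < i}`.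
* For the Hubbard model the orbital set is `Λ ×ₗ Fin 2` (lexicographic order, spin `0 = ↑`,
  `1 = ↓`), for a linearly ordered finite vertex type `Λ` of a `SimpleGraph`.
* Largest eigenvalues are expressed variationally (Rayleigh quotients), so no hermiticity proof
  is needed inside statements.
* The ~15 glue definitions below (Fock space, Jordan–Wigner operators, sectors, expectation
  values, `ρ₂`, Hubbard operators, ground-state energy) belong in a future
  `H21/Prelude/QLattice/` file (with an `InnerProductSpace` instance on `Fock ι`, so that the
  Rayleigh quotients can become `ContinuousLinearMap.rayleighQuotient`); they are kept local
  and minimal here for wave 0.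
-/

namespace Literature.MathematicalPhysics.QuantumLattice

open Matrix Finset Filter
open scoped ComplexOrder

/-! ### S04: Fock space and the CAR -/

section Fock

variable {ι : Type*} [LinearOrder ι]

/-- **hubbard.S04** (glue). The finite fermionic Fock space over the orbital set `ι`, modelled as
`ℓ²` of the set of finite subsets of `ι` (occupation-number basis `|s⟩`, `s : Finset ι`).
Bratteli–Robinson, *Operator Algebras and QSM II* §5.2.2; Tasaki (2020) §9.2. [cite: Tasaki2020] -/
abbrev Fock (ι : Type*) : Type _ := Finset ι → ℂ

/-- The Jordan–Wigner sign `(-1) ^ #{j ∈ s | j < i}` picked up when `c_i` or `c†_i` moves past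
the occupied orbitals below `i`. Tasaki (2020) §9.2. [cite: Tasaki2020] -/
def jwSign (i : ι) (s : Finset ι) : ℂ := (-1) ^ (s.filter (· < i)).card

/-- **hubbard.S04** (glue). The annihilation operator `c_i` as a matrix in the occupation basis:
`c_i |t⟩ = jwSign i s |s⟩` if `t = insert i s` with `i ∉ s`, and `0` otherwise.
Bratteli–Robinson II §5.2.2. [folklore] -/
def annihilation (i : ι) : Matrix (Finset ι) (Finset ι) ℂ :=
  fun s t => if i ∉ s ∧ t = insert i s then jwSign i s else 0

/-- **hubbard.S04** (glue). The creation operator `c†_i`, the conjugate transpose of `c_i`.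
Bratteli–Robinson II §5.2.2. [folklore] -/
def creation (i : ι) : Matrix (Finset ι) (Finset ι) ℂ := (annihilation i)ᴴ

/-- The vacuum vector `|∅⟩`. Bratteli–Robinson II §5.2.2. [folklore] -/
def vacuum : Fock ι := Pi.single (∅ : Finset ι) 1

/-- A Fock vector lies in the `N`-particle sector if it is supported on subsets of cardinality
`N`. Tasaki (2020) §9.2. [cite: Tasaki2020] -/
def IsNParticle (N : ℕ) (ψ : Fock ι) : Prop := ∀ s : Finset ι, s.card ≠ N → ψ s = 0

variable [Fintype ι]

/-- **hubbard.S04** (canonical anticommutation relations, mixed). For the operators above,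
`c_i c†_j + c†_j c_i = δ_{ij}`.
Bratteli–Robinson II §5.2.2, eq. (5.2.11)–(5.2.12); Tasaki (2020) §9.2. [cite: Tasaki2020] -/
def annihilation_mul_creation_add_creation_mul_annihilation : Prop :=
  ∀ (i j : ι),
    annihilation i * creation j + creation j * annihilation i =
      if i = j then (1 : Matrix (Finset ι) (Finset ι) ℂ) else 0

/-- **hubbard.S04** (canonical anticommutation relations, pure). For the operators above,
`c_i c_j + c_j c_i = 0` (and hence, taking adjoints, `c†_i c†_j + c†_j c†_i = 0`).
Bratteli–Robinson II §5.2.2, eq. (5.2.11)–(5.2.12); Tasaki (2020) §9.2. [cite: Tasaki2020] -/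
def annihilation_anticommute : Prop :=
  ∀ (i j : ι),
    annihilation i * annihilation j + annihilation j * annihilation i = 0

/-- The vacuum is annihilated by every `c_i`. Bratteli–Robinson II §5.2.2. [cite: BratteliRobinsonII1997, §5.2.2] -/
def annihilation_mulVec_vacuum : Prop :=
  ∀ (i : ι),
    (annihilation i) *ᵥ (vacuum : Fock ι) = 0

end Fock

/-! ### S06, S07: two-particle reduced density matrix, ODLRO, Yang's bound -/

section ODLRO

variable {ι : Type*} [LinearOrder ι] [Fintype ι]

/-- The expectation value `⟨ψ, A ψ⟩ = star ψ ⬝ᵥ (A ψ)` of an operator in a Fock vector.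
Yang, Rev. Mod. Phys. 34 (1962) 694 §3. [folklore] -/
def expect (A : Matrix (Finset ι) (Finset ι) ℂ) (ψ : Fock ι) : ℂ := star ψ ⬝ᵥ (A *ᵥ ψ)

/-- **hubbard.S06** (glue). Yang's two-particle reduced density matrix
`ρ₂((i,j),(k,l)) = ⟨ψ, c†_i c†_j c_l c_k ψ⟩`. Yang, Rev. Mod. Phys. 34 (1962) 694 §3, eq. (7). [folklore] -/
def twoParticleRDM (ψ : Fock ι) : Matrix (ι × ι) (ι × ι) ℂ :=
  fun p q => expect (creation p.1 * creation p.2 * annihilation q.2 * annihilation q.1) ψ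

/-- **hubbard.S06**. For a normalised `N`-particle state, `ρ₂` is positive semidefinite and
`tr ρ₂ = N(N − 1)`. Yang, Rev. Mod. Phys. 34 (1962) 694 §3. [cite: YangODLRO1962, §3] -/
def twoParticleRDM_posSemidef_and_trace : Prop :=
  ∀ (N : ℕ) (ψ : Fock ι) (hψ : IsNParticle N ψ) (hnorm : star ψ ⬝ᵥ ψ = 1),
    (twoParticleRDM ψ).PosSemidef ∧ (twoParticleRDM ψ).trace = N * (N - 1 : ℂ)

/-- **hubbard.S06** (ODLRO predicate). A sequence of normalised `N L`-fermion states `ψ L` on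
finite orbital sets `κ L`, with particle number `N L → ∞`, exhibits off-diagonal long-range
order if there is `c > 0` such that eventually the largest eigenvalue of `ρ₂^{(L)}` is
`≥ c · N L`; the eigenvalue condition is expressed variationally: some unit pair wavefunction
`v` has `Re ⟨v, ρ₂ v⟩ ≥ c · N L`. The normalisation, `N L`-particle and `N L → ∞` conditions are
part of the predicate (so that it is not vacuously satisfiable by `N ≡ 0` or by rescaling `ψ`).
Yang, Rev. Mod. Phys. 34 (1962) 694 §4; Penrose–Onsager, Phys. Rev. 104 (1956) 576. [folklore] -/
def HasODLRO {κ : ℕ → Type*} [∀ L, LinearOrder (κ L)] [∀ L, Fintype (κ L)] (N : ℕ → ℕ)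
    (ψ : ∀ L, Fock (κ L)) : Prop :=
  (∀ L, IsNParticle (N L) (ψ L) ∧ star (ψ L) ⬝ᵥ ψ L = 1) ∧ Tendsto N atTop atTop ∧
    ∃ c : ℝ, 0 < c ∧ ∀ᶠ L in atTop, ∃ v : κ L × κ L → ℂ,
      star v ⬝ᵥ v = 1 ∧ c * N L ≤ (star v ⬝ᵥ (twoParticleRDM (ψ L) *ᵥ v)).re

/-- **hubbard.S07** (Yang's bound). For any normalised `N`-fermion state on `M = |ι|` orbitals
with `N` even and `N ≤ M`, every Rayleigh quotient of `ρ₂` — hence its largest eigenvalue — is at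
most `N(M − N + 2)/M`. (For `M = 0` both sides vanish.) Yang, Rev. Mod. Phys. 34 (1962) 694,
§3. [cite: YangODLRO1962, §3] -/
def twoParticleRDM_rayleigh_le : Prop :=
  ∀ (N : ℕ) (hN : Even N) (hNM : N ≤ Fintype.card ι) (ψ : Fock ι) (hψ : IsNParticle N ψ) (hnorm : star ψ ⬝ᵥ ψ = 1) (v : ι × ι → ℂ),
    (star v ⬝ᵥ (twoParticleRDM ψ *ᵥ v)).re ≤
      N * (Fintype.card ι - N + 2 : ℝ) / Fintype.card ι * (star v ⬝ᵥ v).re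

/-- **hubbard.S07** (Yang's bound is attained). If moreover `M ≥ 2` is even, some normalised
`N`-fermion state has a unit pair wavefunction whose Rayleigh quotient equals `N(M − N + 2)/M`
("extreme ODLRO"). The hypothesis `Even M` is a (documented) restriction to the setting of
Yang's explicit construction. Yang, Rev. Mod. Phys. 34 (1962) 694, §3. [cite: YangODLRO1962, §3] -/
def exists_twoParticleRDM_rayleigh_eq : Prop :=
  ∀ (N : ℕ) (hN : Even N) (hM : Even (Fintype.card ι)) (hM2 : 2 ≤ Fintype.card ι) (hNM : N ≤ Fintype.card ι),
    ∃ ψ : Fock ι, IsNParticle N ψ ∧ star ψ ⬝ᵥ ψ = 1 ∧ ∃ v : ι × ι → ℂ, star v ⬝ᵥ v = 1 ∧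
      (star v ⬝ᵥ (twoParticleRDM ψ *ᵥ v)).re =
        N * (Fintype.card ι - N + 2 : ℝ) / Fintype.card ι

end ODLRO

/-! ### S05, S09: the Hubbard model and Lieb's theorems -/

section HubbardModel

variable {Λ : Type*} [LinearOrder Λ] [Fintype Λ]

/-- The orbital set of the Hubbard model on `Λ`: pairs (site, spin) in lexicographic order, with
spin `0 = ↑` and `1 = ↓`. Lieb, arXiv:cond-mat/9311033 §2. [cite: arXiv9311033] -/
abbrev Orb (Λ : Type*) : Type _ := Λ ×ₗ Fin 2

/-- The orbital `(x, σ)` of `Orb Λ`, i.e. `toLex (x, σ)`. Lieb, arXiv:cond-mat/9311033 §2. [cite: arXiv9311033] -/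
abbrev orb (x : Λ) (σ : Fin 2) : Orb Λ := toLex (x, σ)

/-- **hubbard.S05** (glue). The number operator `n_{xσ} = c†_{xσ} c_{xσ}`. Lieb (1995) §2. [cite: Lieb1995] -/
def numberOp (x : Λ) (σ : Fin 2) : Matrix (Finset (Orb Λ)) (Finset (Orb Λ)) ℂ :=
  creation (orb x σ) * annihilation (orb x σ)

/-- **hubbard.S05** (glue). Total particle number `N = Σ_{x,σ} n_{xσ}`. Lieb (1995) §2. [cite: Lieb1995] -/
def totalNumber : Matrix (Finset (Orb Λ)) (Finset (Orb Λ)) ℂ :=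
  ∑ x : Λ, ∑ σ : Fin 2, numberOp x σ

/-- **hubbard.S05** (glue). `S^z = ½ Σ_x (n_{x↑} − n_{x↓})`. Lieb (1995) §2. [cite: Lieb1995] -/
noncomputable def HubbardWave0.spinZ : Matrix (Finset (Orb Λ)) (Finset (Orb Λ)) ℂ :=
  (1 / 2 : ℂ) • ∑ x : Λ, (numberOp x 0 - numberOp x 1)

/-- The spin-raising operator `S⁺ = Σ_x c†_{x↑} c_{x↓}` (`S⁻ = (S⁺)ᴴ`). Lieb, PRL 62 (1989)
1201. [folklore] -/
def spinPlus : Matrix (Finset (Orb Λ)) (Finset (Orb Λ)) ℂ :=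
  ∑ x : Λ, creation (orb x 0) * annihilation (orb x 1)

/-- The total-spin Casimir `S² = (S^z)² + ½ (S⁺S⁻ + S⁻S⁺)`. Lieb, PRL 62 (1989) 1201. [folklore] -/
noncomputable def spinSq : Matrix (Finset (Orb Λ)) (Finset (Orb Λ)) ℂ :=
  HubbardWave0.spinZ * HubbardWave0.spinZ + (1 / 2 : ℂ) • (spinPlus * spinPlusᴴ + spinPlusᴴ * spinPlus)

variable (G : SimpleGraph Λ) [DecidableRel G.Adj]

/-- **hubbard.S05**. The Hubbard Hamiltonian on the finite graph `G`,
`H = −t Σ_{⟨xy⟩,σ} (c†_{xσ} c_{yσ} + h.c.) + U Σ_x n_{x↑} n_{x↓}`; the hopping sum runs over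
ordered adjacent pairs, which produces both a term and its Hermitian conjugate.
Hubbard, Proc. R. Soc. A 276 (1963) 238; Lieb, arXiv:cond-mat/9311033 §2. [cite: arXiv9311033] -/
def hamiltonian (t U : ℝ) : Matrix (Finset (Orb Λ)) (Finset (Orb Λ)) ℂ :=
  -(t : ℂ) • (∑ x : Λ, ∑ y : Λ, ∑ σ : Fin 2,
      if G.Adj x y then creation (orb x σ) * annihilation (orb y σ) else 0) +
    (U : ℂ) • ∑ x : Λ, numberOp x 0 * numberOp x 1

/-- **hubbard.S05** (glue). The ground-state energy `E₀(N)` of an operator `H` in the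
`N`-particle sector: the infimum of `Re ⟨ψ, Hψ⟩` over normalised `N`-particle vectors.
(For `N > |ι|` the sector is empty and the value is the junk value `sInf ∅ = 0`.) This is the
lowest eigenvalue in the sector only when `H` is Hermitian and preserves the sector, as is the
case for `hamiltonian` (see `hamiltonian_isHermitian_and_commute`); for general `H` it is merely
a number. Lieb, arXiv:cond-mat/9311033 §2. [cite: arXiv9311033] -/
noncomputable def groundEnergy {ι : Type*} [Fintype ι]
    (H : Matrix (Finset ι) (Finset ι) ℂ) (N : ℕ) : ℝ :=
  sInf {E : ℝ | ∃ ψ : Fock ι, IsNParticle N ψ ∧ star ψ ⬝ᵥ ψ = 1 ∧ E = (expect H ψ).re}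

/-- **hubbard.S05** (glue). `ψ` is a ground state of `H` in the `N`-particle sector: a nonzero
`N`-particle eigenvector with eigenvalue `E₀(N)`. (For non-Hermitian `H` no such vector need
exist; the predicate is intended for `hamiltonian`.) Lieb, arXiv:cond-mat/9311033 §2. [cite: arXiv9311033] -/
def IsGroundState {ι : Type*} [Fintype ι]
    (H : Matrix (Finset ι) (Finset ι) ℂ) (N : ℕ) (ψ : Fock ι) : Prop :=
  IsNParticle N ψ ∧ ψ ≠ 0 ∧ H *ᵥ ψ = ((groundEnergy H N : ℝ) : ℂ) • ψ

/-- **hubbard.S05** (glue). The filling `N/(2|Λ|)` of the `N`-particle sector (half filling is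
`N = |Λ|`). Junk value: for `Λ` empty this is `0` by Mathlib's `x / 0 = 0` convention.
Lieb, arXiv:cond-mat/9311033 §2. [cite: arXiv9311033] -/
noncomputable def HubbardWave0.filling (Λ : Type*) [Fintype Λ] (N : ℕ) : ℝ := N / (2 * Fintype.card Λ)

/-- **hubbard.S05** (glue). Hole doping `δ = 1 − N/|Λ|` of the `N`-particle sector. Junk value:
for `Λ` empty this is `1` by Mathlib's `x / 0 = 0` convention.
Lieb, arXiv:cond-mat/9311033 §2. [cite: arXiv9311033] -/
noncomputable def doping (Λ : Type*) [Fintype Λ] (N : ℕ) : ℝ := 1 - N / Fintype.card Λ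

/-- Lieb's ground-state spin `S = ||A| − |B||/2` attached to a bipartition `Λ = A ⊔ B`,
`B = Aᶜ`. Lieb, PRL 62 (1989) 1201, Theorem 2. [folklore] -/
noncomputable def liebSpin (A : Finset Λ) : ℝ := |(A.card : ℝ) - (Aᶜ.card : ℝ)| / 2

/-- **hubbard.S05**. The Hubbard Hamiltonian is Hermitian and conserves `N` and `S^z`.
Lieb, arXiv:cond-mat/9311033 §2. [cite: arXiv9311033] -/
def hamiltonian_isHermitian_and_commute : Prop :=
  ∀ (t U : ℝ),
    (hamiltonian G t U).IsHermitian ∧ Commute (hamiltonian G t U) totalNumber ∧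
      Commute (hamiltonian G t U) HubbardWave0.spinZ

/-- **hubbard.S09** (Lieb's Theorem 1, attractive case). For `U < 0`, `t ≠ 0` real, `G` connected
and `N` even, the ground state of the Hubbard Hamiltonian in the `N`-particle sector is unique
(up to a scalar) and is a spin singlet, `S²ψ = 0`. Connectivity of `G` and `t ≠ 0`
(irreducibility of the hopping matrix) are hypotheses of Lieb's paper; the inventory text
("any finite Λ") omits them, but uniqueness fails without them.
Lieb, PRL 62 (1989) 1201, Theorem 1. [cite: LiebPRL1989, Theorem 1] -/
def lieb_attractive : Prop :=
  ∀ (hG : G.Connected) (t U : ℝ) (ht : t ≠ 0) (hU : U < 0) (N : ℕ) (hN : Even N) (hNle : N ≤ 2 * Fintype.card Λ),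
    (∀ ψ φ : Fock (Orb Λ), IsGroundState (hamiltonian G t U) N ψ →
        IsGroundState (hamiltonian G t U) N φ → ∃ a : ℂ, φ = a • ψ) ∧
      ∀ ψ : Fock (Orb Λ), IsGroundState (hamiltonian G t U) N ψ → spinSq *ᵥ ψ = 0

/-- **hubbard.S09** (Lieb's Theorem 2, repulsive half-filled case). For `U > 0`, `t ≠ 0`, `|Λ|`
even, `G` connected and bipartite with colour classes `A`, `B = Λ ∖ A`, at half filling `N = |Λ|`
every ground state
has total spin `S = liebSpin A = ||A| − |B||/2`, i.e. `S²ψ = S(S+1)ψ`, and the ground state is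
unique apart from the `(2S+1)`-fold spin degeneracy: the ground eigenspace in the `N`-particle
sector has dimension `2S + 1` (an equality of real numbers, the `finrank` being coerced).
Connectivity and `t ≠ 0` as in Lieb's paper.
Lieb, PRL 62 (1989) 1201 (Erratum 62, 1927), Theorem 2. [cite: LiebPRL1989, Theorem 2] -/
def lieb_repulsive_halfFilling : Prop :=
  ∀ (hG : G.Connected) (A : Finset Λ) (hA : ∀ x y : Λ, G.Adj x y → (x ∈ A ↔ y ∉ A)) (hΛ : Even (Fintype.card Λ)) (t U : ℝ) (ht : t ≠ 0) (hU : 0 < U) (N : ℕ) (hN : N = Fintype.card Λ),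
    (∀ ψ : Fock (Orb Λ), IsGroundState (hamiltonian G t U) N ψ →
        spinSq *ᵥ ψ = ((liebSpin A * (liebSpin A + 1) : ℝ) : ℂ) • ψ) ∧
      (Module.finrank ℂ
          ↥(LinearMap.ker (Matrix.toLin' (hamiltonian G t U -
              ((groundEnergy (hamiltonian G t U) N : ℝ) : ℂ) • 1)) ⊓
            LinearMap.ker (Matrix.toLin' (totalNumber - (N : ℂ) • (1 : Matrix _ _ ℂ)))) : ℝ) =
        2 * liebSpin A + 1

end HubbardModel

end Literature.MathematicalPhysics.QuantumLattice
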